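import Summits.Ventures.LatticeQCDFlow.Scaling.OneAttemptCertificate
import Summits.Ventures.LatticeQCDFlow.Scaling.AttemptIterates
import Summits.Ventures.LatticeQCDFlow.Scaling.TailTruncation

/-!
HONEST FRAMING: exact (Metropolis-corrected) sampling algorithms for lattice gauge theory; figures
of merit are autocorrelation/cost numbers at stated couplings and volumes; no continuum-physics
claim.

# TaggedHubCertificate — THE HUB CHAIN WITH ONE LEVEL PARTICLE TAGGED (STATE SPACE `S ⊕ {★}`), AND THE ONE-CHAIN ★-CERTIFICATE: FROM ANY ORDINARY HUB, FOR EVERY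
# HORIZON `J`, `Σ_{j≤J} [(K + M)·P(X_j = ★) − E(1 − θ(X_j))] ≥ (1 − θ_s)·P(X_J = ★) ≥ 0` — THE TAGGED PARTICLE'S CUMULATIVE HUB OCCUPATION, TIMES `K + M`, PAYS THE
# CUMULATIVE IMPERSISTENCE OF THE HUB (lean-2 GEN-37, ours)

Venture-side (OURS).  Cell `lqcd-flow` (pub-lqcd), unit `pub-lqcd-lean-2-g37`, 2026-08-29.  Chapter W (item 1 (i) at finite swap odds), file 14.  MEMO-gen37 §2–§3: after the
path-coupling reduction only ADJACENT equal-hub pairs matter (`N_X = N_C + δ_a`, `N_Y = N_C + δ_b`, the two copies differ in ONE particle), and for such a pair the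
gain of chapter V file 2 is an EXACT linear expression once the extra particle is TAGGED in the hub chain: the chain lives on `Option S` — `some v` = an ordinary particle of
content `v` in the hub, `none` = ★ = the tagged particle (content `s`) in the hub — with the rates of `Scaling/StarHubChainFirstOrder`: from an ordinary hub `h`
(`N_C(h) ≥ 1`; ordinary levels `N_C − δ_h` and the tagged particle) to ordinary `v ≠ h` at `N_C(v)acc(h,v)/K`, to ★ at `acc(h,s)/K`; from ★ (levels = `N_C`) to `v` at
`N_C(v)acc(s,v)/K`; diagonals complete the rows (`Σ_v N_C(v) = K`).  THE ★-CERTIFICATE: with `M = Σ_vθ_vN_C(v) + θ_s` (the `θ`-mass of all `K+1` particles), the reward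
`r = (K+M)·𝟙_★ − (1 − θ)` (`θ(★) = θ_s`) and `Λ = −(1−θ_s)·𝟙_★`, the super-solution inequality `Λ ≤ P(r + Λ)` of `Scaling/AttemptIterates` holds state by state — at an
ordinary `v` it is `(K + M − 2(1−θ_s))·acc(v,s)/K ≥ E[1−θ(X_1); X_1 ordinary | X_0 = v]`, which follows from `acc(v,s) ≥ pW_v`, the key inequality
`acc(v,w)(1−θ_w) ≤ pW_vθ_w` of chapter W file 4 and `θ ≥ ½`; at ★ it is `Σ_v N_C(v)acc(s,v)(1−θ_v)/K ≤ 1 − θ_s`, which is the key inequality again (`W_v ≥ W_s`) or the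
monotonicity of `W ↦ pW/(1+pW)` (`W_v ≤ W_s`) — hence (`cumulative_ge_of_supersolution`) FOR EVERY ORDINARY START AND EVERY `J`:
`Σ_{j=1}^{J} E[r(X_j)] ≥ (1−θ_s)·P(X_J = ★) ≥ 0`, and the same for the tail resolvent at every `σ ∈ [0,1)` (discounted super-solution principle, proved here).
This is the `X`-half of the linear criterion of MEMO-gen37 (the copy holding the MORE persistent extra particle); hypothesis-equations, no definitions.

## What is proved

* §1 `tagged_in_nonneg`, `tagged_off_nonneg`, `tagged_out_nonneg`, `tagged_offRow_le`, `tagged_outRow_le`, **`tagged_nonneg`**, **`tagged_rowsum`**.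
* §2 `tagged_acc_tag_ge` (`acc(v,s) ≥ pW_v`), `tagged_out_cost_le` (`acc(s,v)(1−θ_v) ≤ 1−θ_s`), **`tagged_supersolution_some`**, **`tagged_supersolution_none`**,
  **`tagged_supersolution`**.
* §3 **`tagged_certificate_cumulative`** (`Σ_{j<n}E_{J_{j+1}}[r] ≥ (1−θ_s)·J_n(★)`), `tagged_certificate_cumulative_nonneg`.
* §4 `tail_expect_ge_of_supersolution` (generic: `ũ = (1−σ)P(z,·) + σũP`, `Λ ≤ P(r+Λ)` ⇒ `E_ũ r ≥ (1−σ)(Λ(z) − E_ũΛ)`), **`tagged_certificate_tail`**.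

Reading (no numerics implied): one of the two linear halves into which the adjacent-pair criterion splits under domination (MEMO-gen37 §3); NOT CLAIMED: the other half,
domination, or anything about two copies.  Literature grade (cell rule): OWN, elementary; nothing cited as a fact; no new bib keys.
-/

open Finset

namespace Summit.Ventures.LatticeQCDFlow.Scaling

section Tagged
variable {S : Type*} [Fintype S] [DecidableEq S]
variable {W θ : S → ℝ} {acc : S → S → ℝ} {p : ℝ} {K : ℕ} {NC : S → ℕ} {s : S} {P : Option S → Option S → ℝ}

/-! ## §1 The tagged hub chain is a stochastic matrix on `Option S` -/

omit [Fintype S] [DecidableEq S] in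
/-- The rate into ★ is non-negative. [ours] -/
theorem tagged_in_nonneg (hW : ∀ v, 0 < W v) (hacc : ∀ h v, acc h v = min 1 (W h / W v))
    (hPin : ∀ h, P (some h) none = if NC h = 0 then 0 else acc h s / K) (h : S) : 0 ≤ P (some h) none := by
  rw [hPin]; split_ifs
  · exact le_rfl
  · exact div_nonneg (starHub_acc_nonneg hW hacc h s) (Nat.cast_nonneg _)

omit [Fintype S] [DecidableEq S] in
/-- Ordinary off-diagonal rates are non-negative. [ours] -/
theorem tagged_off_nonneg (hW : ∀ v, 0 < W v) (hacc : ∀ h v, acc h v = min 1 (W h / W v))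
    (hPoff : ∀ h v, h ≠ v → P (some h) (some v) = if NC h = 0 then 0 else (NC v : ℝ) / K * acc h v) {h v : S} (hhv : h ≠ v) :
    0 ≤ P (some h) (some v) := by
  rw [hPoff h v hhv]; split_ifs
  · exact le_rfl
  · exact mul_nonneg (div_nonneg (Nat.cast_nonneg _) (Nat.cast_nonneg _)) (starHub_acc_nonneg hW hacc h v)

omit [Fintype S] [DecidableEq S] in
/-- The rates out of ★ are non-negative. [ours] -/
theorem tagged_out_nonneg (hW : ∀ v, 0 < W v) (hacc : ∀ h v, acc h v = min 1 (W h / W v))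
    (hPout : ∀ v, P none (some v) = (NC v : ℝ) / K * acc s v) (v : S) : 0 ≤ P none (some v) := by
  rw [hPout]; exact mul_nonneg (div_nonneg (Nat.cast_nonneg _) (Nat.cast_nonneg _)) (starHub_acc_nonneg hW hacc s v)

/-- From an ordinary hub the off-diagonal row mass is at most one (`Σ_v N_C(v) = K`, `N_C(h) ≥ 1`). [ours] -/
theorem tagged_offRow_le (hacc : ∀ h v, acc h v = min 1 (W h / W v))
    (hPoff : ∀ h v, h ≠ v → P (some h) (some v) = if NC h = 0 then 0 else (NC v : ℝ) / K * acc h v)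
    (hPin : ∀ h, P (some h) none = if NC h = 0 then 0 else acc h s / K) (hK : 1 ≤ K) (hNC : ∑ v, NC v = K) (h : S) :
    ∑ v ∈ univ.erase h, P (some h) (some v) + P (some h) none ≤ 1 := by
  by_cases hN : NC h = 0
  · rw [sum_eq_zero fun v hv => by rw [hPoff h v (ne_of_mem_erase hv).symm, if_pos hN], hPin, if_pos hN]; norm_num
  · have hK0 : (0 : ℝ) < K := by exact_mod_cast hK
    have hNh : (1 : ℝ) ≤ NC h := by exact_mod_cast Nat.one_le_iff_ne_zero.mpr hN
    have h1 : ∑ v ∈ univ.erase h, P (some h) (some v) ≤ ∑ v ∈ univ.erase h, (NC v : ℝ) / K := by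
      refine sum_le_sum fun v hv => ?_
      rw [hPoff h v (ne_of_mem_erase hv).symm, if_neg hN]
      calc (NC v : ℝ) / K * acc h v ≤ (NC v : ℝ) / K * 1 := mul_le_mul_of_nonneg_left (starHub_acc_le_one hacc h v) (div_nonneg (Nat.cast_nonneg _) hK0.le)
        _ = (NC v : ℝ) / K := mul_one _
    have h2 : P (some h) none ≤ 1 / K := by
      rw [hPin, if_neg hN]; exact div_le_div_of_nonneg_right (starHub_acc_le_one hacc h s) hK0.le
    have h3 : ∑ v ∈ univ.erase h, (NC v : ℝ) / K = ((K : ℝ) - NC h) / K := by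
      have e : ∑ v ∈ univ.erase h, (NC v : ℝ) + (NC h : ℝ) = K := by
        rw [Finset.sum_erase_add univ (fun v => (NC v : ℝ)) (mem_univ h), ← Nat.cast_sum, hNC]
      rw [← sum_div]; congr 1; linarith
    calc ∑ v ∈ univ.erase h, P (some h) (some v) + P (some h) none ≤ ((K : ℝ) - NC h) / K + 1 / K := by linarith [h1, h2, h3]
      _ = ((K : ℝ) - NC h + 1) / K := by ring
      _ ≤ 1 := by rw [div_le_one hK0]; linarith

omit [DecidableEq S] in
/-- From ★ the row mass into the levels is at most one. [ours] -/
theorem tagged_outRow_le (hacc : ∀ h v, acc h v = min 1 (W h / W v)) (hPout : ∀ v, P none (some v) = (NC v : ℝ) / K * acc s v)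
    (hK : 1 ≤ K) (hNC : ∑ v, NC v = K) : ∑ v, P none (some v) ≤ 1 := by
  have hK0 : (0 : ℝ) < K := by exact_mod_cast hK
  calc ∑ v, P none (some v) ≤ ∑ v, (NC v : ℝ) / K := by
        refine sum_le_sum fun v _ => ?_
        rw [hPout]
        calc (NC v : ℝ) / K * acc s v ≤ (NC v : ℝ) / K * 1 := mul_le_mul_of_nonneg_left (starHub_acc_le_one hacc s v) (div_nonneg (Nat.cast_nonneg _) hK0.le)
          _ = (NC v : ℝ) / K := mul_one _
    _ = 1 := by rw [← sum_div, ← Nat.cast_sum, hNC, div_self hK0.ne']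

omit [DecidableEq S] in
/-- Sums over `Option S` split into the ★ term and the ordinary terms. [ours] -/
theorem tagged_sum_option (f : Option S → ℝ) : ∑ t, f t = f none + ∑ v, f (some v) := Fintype.sum_option f

/-- **The tagged hub chain is non-negative.** [ours] -/
theorem tagged_nonneg (hW : ∀ v, 0 < W v) (hacc : ∀ h v, acc h v = min 1 (W h / W v))
    (hPoff : ∀ h v, h ≠ v → P (some h) (some v) = if NC h = 0 then 0 else (NC v : ℝ) / K * acc h v)
    (hPin : ∀ h, P (some h) none = if NC h = 0 then 0 else acc h s / K)
    (hPdiag : ∀ h, P (some h) (some h) = 1 - (∑ v ∈ univ.erase h, P (some h) (some v) + P (some h) none))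
    (hPout : ∀ v, P none (some v) = (NC v : ℝ) / K * acc s v) (hPstay : P none none = 1 - ∑ v, P none (some v))
    (hK : 1 ≤ K) (hNC : ∑ v, NC v = K) : ∀ t t', 0 ≤ P t t' := by
  intro t t'
  rcases t with _ | h <;> rcases t' with _ | v
  · rw [hPstay]; linarith [tagged_outRow_le hacc hPout hK hNC]
  · exact tagged_out_nonneg hW hacc hPout v
  · exact tagged_in_nonneg hW hacc hPin h
  · by_cases hhv : h = v
    · subst hhv; rw [hPdiag]; linarith [tagged_offRow_le hacc hPoff hPin hK hNC h]
    · exact tagged_off_nonneg hW hacc hPoff hhv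

/-- **The rows of the tagged hub chain sum to one.** [ours] -/
theorem tagged_rowsum (hPdiag : ∀ h, P (some h) (some h) = 1 - (∑ v ∈ univ.erase h, P (some h) (some v) + P (some h) none))
    (hPstay : P none none = 1 - ∑ v, P none (some v)) : ∀ t, ∑ t', P t t' = 1 := by
  intro t
  rw [tagged_sum_option]
  rcases t with _ | h
  · rw [hPstay]; ring
  · rw [← Finset.sum_erase_add univ (fun v => P (some h) (some v)) (mem_univ h), hPdiag]; ring

/-! ## §2 The super-solution conditions -/

omit [Fintype S] [DecidableEq S] in
/-- `acc(v,s) ≥ p·W_v` (the acceptance floor of chapter W file 4, read for the tagged particle). [ours] -/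
theorem tagged_acc_tag_ge (hW : ∀ v, 0 < W v) (hp : ∀ v, p * W v ≤ 1) (hacc : ∀ h v, acc h v = min 1 (W h / W v)) (v : S) :
    p * W v ≤ acc v s := starHub_acc_ge hW hp hacc v s

omit [Fintype S] [DecidableEq S] in
/-- **The cost of the particle that displaces the tagged one:** `acc(s,v)·(1 − θ_v) ≤ 1 − θ_s` (`W_v ≥ W_s`: the key inequality and `θ_v ≤ θ_s`… no — `θ_s·pW_s = 1−θ_s`;
`W_v ≤ W_s`: `acc = 1` and `1−θ_v = pW_vθ_v ≤ pW_sθ_s` by monotonicity of `W ↦ pW/(1+pW)`). [ours] -/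
theorem tagged_out_cost_le (hW : ∀ v, 0 < W v) (hp0 : 0 ≤ p) (hθ : ∀ v, θ v = 1 / (1 + p * W v))
    (hacc : ∀ h v, acc h v = min 1 (W h / W v)) (v : S) : acc s v * (1 - θ v) ≤ 1 - θ s := by
  have hWs := hW s; have hWv := hW v
  have hds : 0 < 1 + p * W s := by nlinarith [mul_nonneg hp0 hWs.le]
  have hdv : 0 < 1 + p * W v := by nlinarith [mul_nonneg hp0 hWv.le]
  have es : 1 - θ s = p * W s / (1 + p * W s) := by rw [hθ s]; field_simp; ring
  have ev : 1 - θ v = p * W v / (1 + p * W v) := by rw [hθ v]; field_simp; ring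
  rw [es, ev, hacc]
  rcases le_total (W v) (W s) with hle | hle
  · -- `acc = 1`, monotonicity of `x ↦ x/(1+x)`
    have h1 : 1 ≤ W s / W v := by rw [le_div_iff₀ hWv]; linarith
    rw [min_eq_left h1, one_mul, div_le_div_iff₀ hdv hds]
    nlinarith [mul_le_mul_of_nonneg_left hle hp0]
  · -- `acc = W_s/W_v`
    have h1 : W s / W v ≤ 1 := by rw [div_le_one hWv]; exact hle
    rw [min_eq_right h1, div_mul_div_comm, div_le_div_iff₀ (mul_pos hWv hdv) hds]
    have : 0 ≤ p * W s * (p * (W v - W s)) * W v := by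
      have h2 : 0 ≤ W v - W s := by linarith
      positivity
    nlinarith [this]

/-- **The super-solution condition at an ordinary hub `v`** (`N_C(v) ≥ 1`): with `r = (K+M)𝟙_★ − (1−θ)`, `Λ = −(1−θ_s)𝟙_★`,
`Λ(v) = 0 ≤ Σ_t P(v,t)(r(t) + Λ(t))`, i.e. `(K + M − 2(1−θ_s))·acc(v,s)/K ≥ P(v,v)(1−θ_v) + Σ_{w≠v} (N_C(w)acc(v,w)/K)(1−θ_w)`. [ours] -/
theorem tagged_supersolution_some (hW : ∀ v, 0 < W v) (hp0 : 0 ≤ p) (hp : ∀ v, p * W v ≤ 1) (hθ : ∀ v, θ v = 1 / (1 + p * W v))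
    (hacc : ∀ h v, acc h v = min 1 (W h / W v))
    (hPoff : ∀ h v, h ≠ v → P (some h) (some v) = if NC h = 0 then 0 else (NC v : ℝ) / K * acc h v)
    (hPin : ∀ h, P (some h) none = if NC h = 0 then 0 else acc h s / K)
    (hPdiag : ∀ h, P (some h) (some h) = 1 - (∑ v ∈ univ.erase h, P (some h) (some v) + P (some h) none))
    (hK : 1 ≤ K) (hNC : ∑ v, NC v = K) {M : ℝ} (hM : M = ∑ v, θ v * (NC v : ℝ) + θ s)
    {r Λ : Option S → ℝ} (hrn : r none = (K + M) - (1 - θ s)) (hrs : ∀ v, r (some v) = -(1 - θ v))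
    (hΛn : Λ none = -(1 - θ s)) (hΛs : ∀ v, Λ (some v) = 0) {v : S} (hv : NC v ≠ 0) :
    Λ (some v) ≤ ∑ t, P (some v) t * (r t + Λ t) := by
  have hθm := theta_mem hW hp0 hp hθ
  have hK0 : (0 : ℝ) < K := by exact_mod_cast hK
  have hpW0 : 0 ≤ p * W v := mul_nonneg hp0 (hW v).le
  rw [hΛs, tagged_sum_option, hrn, hΛn]
  simp_rw [hrs, hΛs, add_zero]
  -- split the ordinary sum at `v`
  rw [← Finset.sum_erase_add univ (fun w => P (some v) (some w) * -(1 - θ w)) (mem_univ v)]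
  set A : ℝ := ∑ w ∈ univ.erase v, P (some v) (some w) with hA
  have hin : P (some v) none = acc v s / K := by rw [hPin, if_neg hv]
  have hdiag : P (some v) (some v) = 1 - (A + acc v s / K) := by rw [hPdiag, ← hin]
  -- (i) the in-rate is at least `pW_v/K`
  have hfl : p * W v / K ≤ acc v s / K := div_le_div_of_nonneg_right (tagged_acc_tag_ge hW hp hacc v) hK0.le
  -- (ii) the off-diagonal cost: `Σ_{w≠v} P(v,w)(1−θ_w) ≤ (pW_v/K)·Σ_{w≠v} N_C(w)θ_w`
  have hoff : ∑ w ∈ univ.erase v, P (some v) (some w) * (1 - θ w) ≤ p * W v / K * ∑ w ∈ univ.erase v, (NC w : ℝ) * θ w := by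
    rw [mul_sum]
    refine sum_le_sum fun w hw => ?_
    rw [hPoff v w (ne_of_mem_erase hw).symm, if_neg hv]
    have hk := starHub_theta_acc_key hW hp0 hθ hacc v w
    have hNK : 0 ≤ (NC w : ℝ) / K := div_nonneg (Nat.cast_nonneg _) hK0.le
    calc (NC w : ℝ) / K * acc v w * (1 - θ w) = (NC w : ℝ) / K * (acc v w * (1 - θ w)) := by ring
      _ ≤ (NC w : ℝ) / K * (p * W v * θ w) := mul_le_mul_of_nonneg_left hk hNK
      _ = p * W v / K * ((NC w : ℝ) * θ w) := by ring
  -- (iii) the levels' mass: `Σ_{w≠v} N_C(w)θ_w ≤ M − θ_s − θ_v`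
  have hlev : ∑ w ∈ univ.erase v, (NC w : ℝ) * θ w + θ v ≤ M - θ s := by
    have hθ0 : ∀ w, 0 ≤ θ w := fun w => by linarith [(hθm w).1]
    have h := oneAttempt_mass_ge hθ0 (N := NC) hv
    rw [hM]; linarith
  -- (iv) the diagonal cost: `P(v,v)(1−θ_v) ≤ 1−θ_v = pW_vθ_v`
  have hdc : P (some v) (some v) * (1 - θ v) ≤ p * W v * θ v := by
    have e : 1 - θ v = p * W v * θ v := by
      have hden : 0 < 1 + p * W v := by linarith
      rw [hθ v]; field_simp; ring
    have hA0 : 0 ≤ A := sum_nonneg fun w hw => tagged_off_nonneg hW hacc hPoff (ne_of_mem_erase hw).symm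
    have hP1 : P (some v) (some v) ≤ 1 := by
      rw [hdiag]; linarith [div_nonneg (starHub_acc_nonneg hW hacc v s) hK0.le]
    have hP0 : 0 ≤ P (some v) (some v) := by rw [hdiag]; linarith [tagged_offRow_le hacc hPoff hPin hK hNC v]
    rw [e]; exact mul_le_of_le_one_left (by rw [← e]; linarith [(hθm v).2]) hP1
  -- assemble: the target is `0 ≤ −Σ_{w≠v}P(1−θ_w) − P(v,v)(1−θ_v) + (acc/K)((K+M) − 2(1−θ_s))`
  have hmass0 : 0 ≤ ∑ w ∈ univ.erase v, (NC w : ℝ) * θ w := sum_nonneg fun w _ => mul_nonneg (Nat.cast_nonneg _) (by linarith [(hθm w).1])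
  have hcoef : 0 ≤ (K : ℝ) + M - 2 * (1 - θ s) := by
    have : (1 : ℝ) ≤ K := by exact_mod_cast hK
    rw [hM]; nlinarith [(hθm s).1, sum_nonneg fun w (_ : w ∈ univ) => mul_nonneg (by linarith [(hθm w).1] : 0 ≤ θ w) (Nat.cast_nonneg (NC w))]
  have hneg : ∑ w ∈ univ.erase v, P (some v) (some w) * -(1 - θ w) = -∑ w ∈ univ.erase v, P (some v) (some w) * (1 - θ w) := by rw [← sum_neg_distrib]; exact sum_congr rfl fun w _ => by ring
  rw [hneg, hin]
  have hgain : p * W v / K * ((K : ℝ) + M - 2 * (1 - θ s)) ≤ acc v s / K * ((K : ℝ) + M - 2 * (1 - θ s)) := mul_le_mul_of_nonneg_right hfl hcoef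
  -- the room: `pW_v[(1−θ_v) + (3θ_s + θ_v − 2)/K] ≥ 0`
  have hroom : 0 ≤ p * W v / K * ((K : ℝ) + M - 2 * (1 - θ s)) - p * W v * θ v - p * W v / K * (M - θ s - θ v) := by
    have e : p * W v / K * ((K : ℝ) + M - 2 * (1 - θ s)) - p * W v * θ v - p * W v / K * (M - θ s - θ v)
        = p * W v * (1 - θ v) + p * W v / K * (3 * θ s + θ v - 2) := by field_simp; ring
    rw [e]
    have h1 : 0 ≤ 3 * θ s + θ v - 2 := by linarith [(hθm s).1, (hθm v).1]
    have h2 : 0 ≤ 1 - θ v := by linarith [(hθm v).2]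
    positivity
  have hexp : p * W v / K * ∑ w ∈ univ.erase v, (NC w : ℝ) * θ w ≤ p * W v / K * (M - θ s - θ v) :=
    mul_le_mul_of_nonneg_left (by linarith) (div_nonneg hpW0 hK0.le)
  nlinarith [hoff, hdc, hgain, hroom, hexp]

omit [DecidableEq S] in
/-- **The super-solution condition at ★:** `Λ(★) = −(1−θ_s) ≤ Σ_t P(★,t)(r(t) + Λ(t))`, i.e. `Σ_v N_C(v)acc(s,v)(1−θ_v)/K ≤ (1−θ_s) + (K+M−2(1−θ_s))·P(★,★)`. [ours] -/
theorem tagged_supersolution_none (hW : ∀ v, 0 < W v) (hp0 : 0 ≤ p) (hp : ∀ v, p * W v ≤ 1) (hθ : ∀ v, θ v = 1 / (1 + p * W v))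
    (hacc : ∀ h v, acc h v = min 1 (W h / W v))
    (hPout : ∀ v, P none (some v) = (NC v : ℝ) / K * acc s v) (hPstay : P none none = 1 - ∑ v, P none (some v))
    (hK : 1 ≤ K) (hNC : ∑ v, NC v = K) {M : ℝ} (hM : M = ∑ v, θ v * (NC v : ℝ) + θ s)
    {r Λ : Option S → ℝ} (hrn : r none = (K + M) - (1 - θ s)) (hrs : ∀ v, r (some v) = -(1 - θ v))
    (hΛn : Λ none = -(1 - θ s)) (hΛs : ∀ v, Λ (some v) = 0) :
    Λ none ≤ ∑ t, P none t * (r t + Λ t) := by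
  have hθm := theta_mem hW hp0 hp hθ
  have hK0 : (0 : ℝ) < K := by exact_mod_cast hK
  rw [hΛn, tagged_sum_option, hrn, hΛn, hPstay]
  simp_rw [hrs, hΛs, add_zero]
  -- the exit cost: `Σ_v P(★,v)(1−θ_v) ≤ (1−θ_s)·Σ_v N_C(v)/K = 1−θ_s`
  have hcost : ∑ v, P none (some v) * (1 - θ v) ≤ 1 - θ s := by
    calc ∑ v, P none (some v) * (1 - θ v) = ∑ v, (NC v : ℝ) / K * (acc s v * (1 - θ v)) := sum_congr rfl fun v _ => by rw [hPout]; ring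
      _ ≤ ∑ v, (NC v : ℝ) / K * (1 - θ s) := sum_le_sum fun v _ =>
          mul_le_mul_of_nonneg_left (tagged_out_cost_le hW hp0 hθ hacc v) (div_nonneg (Nat.cast_nonneg _) hK0.le)
      _ = 1 - θ s := by rw [← sum_mul, ← sum_div, ← Nat.cast_sum, hNC, div_self hK0.ne', one_mul]
  have hβ := tagged_outRow_le hacc hPout hK hNC
  have hcoef : 0 ≤ (K : ℝ) + M - 2 * (1 - θ s) := by
    have : (1 : ℝ) ≤ K := by exact_mod_cast hK
    rw [hM]; nlinarith [(hθm s).1, sum_nonneg fun w (_ : w ∈ univ) => mul_nonneg (by linarith [(hθm w).1] : 0 ≤ θ w) (Nat.cast_nonneg (NC w))]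
  have hneg : ∑ v, P none (some v) * -(1 - θ v) = -∑ v, P none (some v) * (1 - θ v) := by rw [← sum_neg_distrib]; exact sum_congr rfl fun v _ => by ring
  rw [hneg]; nlinarith [mul_nonneg (sub_nonneg.mpr hβ) hcoef]

/-- **The super-solution inequality `Λ ≤ P(r + Λ)` on all of `Option S`** (every content present: `N_C(v) ≠ 0` for all `v`). [ours] -/
theorem tagged_supersolution (hW : ∀ v, 0 < W v) (hp0 : 0 ≤ p) (hp : ∀ v, p * W v ≤ 1) (hθ : ∀ v, θ v = 1 / (1 + p * W v))
    (hacc : ∀ h v, acc h v = min 1 (W h / W v))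
    (hPoff : ∀ h v, h ≠ v → P (some h) (some v) = if NC h = 0 then 0 else (NC v : ℝ) / K * acc h v)
    (hPin : ∀ h, P (some h) none = if NC h = 0 then 0 else acc h s / K)
    (hPdiag : ∀ h, P (some h) (some h) = 1 - (∑ v ∈ univ.erase h, P (some h) (some v) + P (some h) none))
    (hPout : ∀ v, P none (some v) = (NC v : ℝ) / K * acc s v) (hPstay : P none none = 1 - ∑ v, P none (some v))
    (hK : 1 ≤ K) (hNC : ∑ v, NC v = K) (hpres : ∀ v, NC v ≠ 0) {M : ℝ} (hM : M = ∑ v, θ v * (NC v : ℝ) + θ s)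
    {r Λ : Option S → ℝ} (hrn : r none = (K + M) - (1 - θ s)) (hrs : ∀ v, r (some v) = -(1 - θ v))
    (hΛn : Λ none = -(1 - θ s)) (hΛs : ∀ v, Λ (some v) = 0) : ∀ t, Λ t ≤ ∑ t', P t t' * (r t' + Λ t') := by
  intro t
  rcases t with _ | v
  · exact tagged_supersolution_none hW hp0 hp hθ hacc hPout hPstay hK hNC hM hrn hrs hΛn hΛs
  · exact tagged_supersolution_some hW hp0 hp hθ hacc hPoff hPin hPdiag hK hNC hM hrn hrs hΛn hΛs (hpres v)

/-! ## §3 The cumulative ★-certificate -/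

/-- **THE ★-CERTIFICATE, CUMULATIVE FORM.**  For the tagged hub chain (every content present, `Σ N_C = K ≥ 1`), iterates `J_0 = δ_(some z)`, `J_{j+1} = J_jP` from an
ordinary hub `z`, and `M = Σ_vθ_vN_C(v) + θ_s`: for every `n`,
`Σ_{j<n} [(K+M)·J_{j+1}(★) − Σ_v J_{j+1}(v)(1−θ_v) − J_{j+1}(★)(1−θ_s)] ≥ (1−θ_s)·J_n(★)`. [ours] -/
theorem tagged_certificate_cumulative (hW : ∀ v, 0 < W v) (hp0 : 0 ≤ p) (hp : ∀ v, p * W v ≤ 1) (hθ : ∀ v, θ v = 1 / (1 + p * W v))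
    (hacc : ∀ h v, acc h v = min 1 (W h / W v))
    (hPoff : ∀ h v, h ≠ v → P (some h) (some v) = if NC h = 0 then 0 else (NC v : ℝ) / K * acc h v)
    (hPin : ∀ h, P (some h) none = if NC h = 0 then 0 else acc h s / K)
    (hPdiag : ∀ h, P (some h) (some h) = 1 - (∑ v ∈ univ.erase h, P (some h) (some v) + P (some h) none))
    (hPout : ∀ v, P none (some v) = (NC v : ℝ) / K * acc s v) (hPstay : P none none = 1 - ∑ v, P none (some v))
    (hK : 1 ≤ K) (hNC : ∑ v, NC v = K) (hpres : ∀ v, NC v ≠ 0) {M : ℝ} (hM : M = ∑ v, θ v * (NC v : ℝ) + θ s)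
    {z : S} {Jt : ℕ → Option S → ℝ} (hJ0 : ∀ t, Jt 0 t = if t = some z then 1 else 0) (hJS : ∀ j t, Jt (j + 1) t = ∑ t', Jt j t' * P t' t) (n : ℕ) :
    (1 - θ s) * Jt n none
      ≤ ∑ j ∈ range n, ((K + M) * Jt (j + 1) none - (∑ v, Jt (j + 1) (some v) * (1 - θ v) + Jt (j + 1) none * (1 - θ s))) := by
  set r : Option S → ℝ := fun t => Option.elim t ((K + M) - (1 - θ s)) (fun v => -(1 - θ v)) with hr
  set Λ : Option S → ℝ := fun t => Option.elim t (-(1 - θ s)) (fun _ => 0) with hΛ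
  have hsup := tagged_supersolution hW hp0 hp hθ hacc hPoff hPin hPdiag hPout hPstay hK hNC hpres hM (r := r) (Λ := Λ)
    (by simp [hr]) (fun v => by simp [hr]) (by simp [hΛ]) (fun v => by simp [hΛ])
  have hP0 := tagged_nonneg hW hacc hPoff hPin hPdiag hPout hPstay hK hNC
  have hJ00 : ∀ j t, 0 ≤ Jt j t :=
    tail_iterate_nonneg (K := P) (κ := fun t => if t = some z then (1 : ℝ) else 0) hP0 (fun t => by positivity) hJ0 hJS
  have h := cumulative_ge_of_supersolution hsup hJ00 hJS n
  -- evaluate `E_{J_0}Λ = 0` and `E_{J_n}Λ = −(1−θ_s)J_n(★)`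
  have h0 : ∑ t, Jt 0 t * Λ t = 0 := by
    refine sum_eq_zero fun t _ => ?_
    rw [hJ0]; rcases t with _ | v <;> simp [hΛ]
  have hn : ∑ t, Jt n t * Λ t = -(1 - θ s) * Jt n none := by
    rw [tagged_sum_option]; simp [hΛ]; ring
  have hrew : ∀ j, ∑ t, Jt (j + 1) t * r t = (K + M) * Jt (j + 1) none - (∑ v, Jt (j + 1) (some v) * (1 - θ v) + Jt (j + 1) none * (1 - θ s)) := by
    intro j
    rw [tagged_sum_option]; simp only [hr, Option.elim_none, Option.elim_some]
    have e : ∑ v, Jt (j + 1) (some v) * -(1 - θ v) = -∑ v, Jt (j + 1) (some v) * (1 - θ v) := by rw [← sum_neg_distrib]; exact sum_congr rfl fun v _ => by ring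
    rw [e]; ring
  rw [h0, hn] at h
  calc (1 - θ s) * Jt n none = 0 - -(1 - θ s) * Jt n none := by ring
    _ ≤ ∑ j ∈ range n, ∑ t, Jt (j + 1) t * r t := h
    _ = _ := sum_congr rfl fun j _ => hrew j

/-- **… hence all cumulative expected rewards are non-negative** (`θ_s ≤ 1`, `J_n ≥ 0`). [ours] -/
theorem tagged_certificate_cumulative_nonneg (hW : ∀ v, 0 < W v) (hp0 : 0 ≤ p) (hp : ∀ v, p * W v ≤ 1) (hθ : ∀ v, θ v = 1 / (1 + p * W v))
    (hacc : ∀ h v, acc h v = min 1 (W h / W v))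
    (hPoff : ∀ h v, h ≠ v → P (some h) (some v) = if NC h = 0 then 0 else (NC v : ℝ) / K * acc h v)
    (hPin : ∀ h, P (some h) none = if NC h = 0 then 0 else acc h s / K)
    (hPdiag : ∀ h, P (some h) (some h) = 1 - (∑ v ∈ univ.erase h, P (some h) (some v) + P (some h) none))
    (hPout : ∀ v, P none (some v) = (NC v : ℝ) / K * acc s v) (hPstay : P none none = 1 - ∑ v, P none (some v))
    (hK : 1 ≤ K) (hNC : ∑ v, NC v = K) (hpres : ∀ v, NC v ≠ 0) {M : ℝ} (hM : M = ∑ v, θ v * (NC v : ℝ) + θ s)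
    {z : S} {Jt : ℕ → Option S → ℝ} (hJ0 : ∀ t, Jt 0 t = if t = some z then 1 else 0) (hJS : ∀ j t, Jt (j + 1) t = ∑ t', Jt j t' * P t' t) (n : ℕ) :
    0 ≤ ∑ j ∈ range n, ((K + M) * Jt (j + 1) none - (∑ v, Jt (j + 1) (some v) * (1 - θ v) + Jt (j + 1) none * (1 - θ s))) := by
  have h := tagged_certificate_cumulative hW hp0 hp hθ hacc hPoff hPin hPdiag hPout hPstay hK hNC hpres hM hJ0 hJS n
  have hθs := (theta_mem hW hp0 hp hθ s).2
  have hP0 := tagged_nonneg hW hacc hPoff hPin hPdiag hPout hPstay hK hNC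
  have hJn : 0 ≤ Jt n none :=
    tail_iterate_nonneg (K := P) (κ := fun t => if t = some z then (1 : ℝ) else 0) hP0 (fun t => by positivity) hJ0 hJS n none
  nlinarith

end Tagged

/-! ## §4 The tail (discounted) form -/

section TailSuper
variable {T : Type*} [Fintype T]

/-- **Discounted super-solution principle for a tail resolvent:** if `ũ = (1−σ)P(z,·) + σ·ũP` (`0 ≤ σ ≤ 1`), `ũ ≥ 0` and `Λ(s) ≤ Σ_t P(s,t)(r(t) + Λ(t))` for every
`s`, then `E_ũ[r] ≥ (1−σ)·(Λ(z) − E_ũ[Λ])`. [ours] -/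
theorem tail_expect_ge_of_supersolution {P : T → T → ℝ} {r Λ ut : T → ℝ} {σ : ℝ} {z : T} (hσ0 : 0 ≤ σ) (hσ1 : σ ≤ 1)
    (hsup : ∀ s, Λ s ≤ ∑ t, P s t * (r t + Λ t)) (hut0 : ∀ t, 0 ≤ ut t)
    (hut : ∀ t, ut t = (1 - σ) * P z t + σ * ∑ s, ut s * P s t) :
    (1 - σ) * (Λ z - ∑ t, ut t * Λ t) ≤ ∑ t, ut t * r t := by
  have expand : ∑ t, ut t * (r t + Λ t) = (1 - σ) * ∑ t, P z t * (r t + Λ t) + σ * ∑ s, ut s * ∑ t, P s t * (r t + Λ t) := by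
    calc ∑ t, ut t * (r t + Λ t) = ∑ t, ((1 - σ) * P z t + σ * ∑ s, ut s * P s t) * (r t + Λ t) :=
          sum_congr rfl fun t _ => by rw [hut t]
      _ = ∑ t, ((1 - σ) * (P z t * (r t + Λ t)) + σ * ∑ s, ut s * P s t * (r t + Λ t)) :=
          sum_congr rfl fun t _ => by rw [add_mul, mul_assoc, mul_assoc, sum_mul]
      _ = (1 - σ) * ∑ t, P z t * (r t + Λ t) + σ * ∑ t, ∑ s, ut s * P s t * (r t + Λ t) := by
          rw [sum_add_distrib, ← mul_sum, ← mul_sum]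
      _ = (1 - σ) * ∑ t, P z t * (r t + Λ t) + σ * ∑ s, ∑ t, ut s * P s t * (r t + Λ t) := by rw [sum_comm]
      _ = (1 - σ) * ∑ t, P z t * (r t + Λ t) + σ * ∑ s, ut s * ∑ t, P s t * (r t + Λ t) := by
          congr 1; congr 1; refine sum_congr rfl fun s _ => ?_; rw [mul_sum]; exact sum_congr rfl fun t _ => by ring
  have h1 : (1 - σ) * Λ z ≤ (1 - σ) * ∑ t, P z t * (r t + Λ t) := mul_le_mul_of_nonneg_left (hsup z) (by linarith)
  have h2 : σ * ∑ s, ut s * Λ s ≤ σ * ∑ s, ut s * ∑ t, P s t * (r t + Λ t) :=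
    mul_le_mul_of_nonneg_left (sum_le_sum fun s _ => mul_le_mul_of_nonneg_left (hsup s) (hut0 s)) hσ0
  have e : ∑ t, ut t * (r t + Λ t) = ∑ t, ut t * r t + ∑ t, ut t * Λ t := by rw [← sum_add_distrib]; exact sum_congr rfl fun t _ => by ring
  have key : (1 - σ) * Λ z + σ * ∑ s, ut s * Λ s ≤ ∑ t, ut t * r t + ∑ t, ut t * Λ t := by rw [← e, expand]; linarith
  linarith

end TailSuper

section TaggedTail
variable {S : Type*} [Fintype S] [DecidableEq S]
variable {W θ : S → ℝ} {acc : S → S → ℝ} {p : ℝ} {K : ℕ} {NC : S → ℕ} {s : S} {P : Option S → Option S → ℝ}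

/-- **THE ★-CERTIFICATE, TAIL FORM.**  For the tail resolvent `ũ = (1−σ)P(some z,·) + σũP` of the tagged hub chain from an ordinary hub `z` (`0 ≤ σ < 1`):
`(K+M)·ũ(★) − Σ_v ũ(v)(1−θ_v) − ũ(★)(1−θ_s) ≥ (1−σ)(1−θ_s)·ũ(★) ≥ 0`. [ours] -/
theorem tagged_certificate_tail (hW : ∀ v, 0 < W v) (hp0 : 0 ≤ p) (hp : ∀ v, p * W v ≤ 1) (hθ : ∀ v, θ v = 1 / (1 + p * W v))
    (hacc : ∀ h v, acc h v = min 1 (W h / W v))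
    (hPoff : ∀ h v, h ≠ v → P (some h) (some v) = if NC h = 0 then 0 else (NC v : ℝ) / K * acc h v)
    (hPin : ∀ h, P (some h) none = if NC h = 0 then 0 else acc h s / K)
    (hPdiag : ∀ h, P (some h) (some h) = 1 - (∑ v ∈ univ.erase h, P (some h) (some v) + P (some h) none))
    (hPout : ∀ v, P none (some v) = (NC v : ℝ) / K * acc s v) (hPstay : P none none = 1 - ∑ v, P none (some v))
    (hK : 1 ≤ K) (hNC : ∑ v, NC v = K) (hpres : ∀ v, NC v ≠ 0) {M : ℝ} (hM : M = ∑ v, θ v * (NC v : ℝ) + θ s)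
    {σ : ℝ} (hσ0 : 0 ≤ σ) (hσ1 : σ < 1) {z : S} {ut : Option S → ℝ} (hut : ∀ t, ut t = (1 - σ) * P (some z) t + σ * ∑ t', ut t' * P t' t) :
    (1 - σ) * (1 - θ s) * ut none ≤ (K + M) * ut none - (∑ v, ut (some v) * (1 - θ v) + ut none * (1 - θ s)) := by
  set r : Option S → ℝ := fun t => Option.elim t ((K + M) - (1 - θ s)) (fun v => -(1 - θ v)) with hr
  set Λ : Option S → ℝ := fun t => Option.elim t (-(1 - θ s)) (fun _ => 0) with hΛ
  have hsup := tagged_supersolution hW hp0 hp hθ hacc hPoff hPin hPdiag hPout hPstay hK hNC hpres hM (r := r) (Λ := Λ)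
    (by simp [hr]) (fun v => by simp [hr]) (by simp [hΛ]) (fun v => by simp [hΛ])
  have hP0 := tagged_nonneg hW hacc hPoff hPin hPdiag hPout hPstay hK hNC
  have hP1 := tagged_rowsum (P := P) hPdiag hPstay
  have hut0 : ∀ t, 0 ≤ ut t := geomResolvent_nonneg hP0 hP1 hσ0 hσ1 (ν := fun t => P (some z) t) (fun t => hP0 _ _) hut
  have h := tail_expect_ge_of_supersolution hσ0 hσ1.le hsup hut0 hut
  have hΛz : Λ (some z) = 0 := by simp [hΛ]
  have hEΛ : ∑ t, ut t * Λ t = -(1 - θ s) * ut none := by rw [tagged_sum_option]; simp [hΛ]; ring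
  have hEr : ∑ t, ut t * r t = (K + M) * ut none - (∑ v, ut (some v) * (1 - θ v) + ut none * (1 - θ s)) := by
    rw [tagged_sum_option]; simp only [hr, Option.elim_none, Option.elim_some]
    have e : ∑ v, ut (some v) * -(1 - θ v) = -∑ v, ut (some v) * (1 - θ v) := by rw [← sum_neg_distrib]; exact sum_congr rfl fun v _ => by ring
    rw [e]; ring
  rw [hΛz, hEΛ, hEr] at h
  linarith

end TaggedTail

end Summit.Ventures.LatticeQCDFlow.Scaling
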